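import Summits.HodgeConjecture.HodgeConjecture.Theorems.Ring2AbelianAllAndreSquareDegrees
import Literature.AlgebraicGeometry.HodgeTheory.GysinBaseChangeOfKunneth
import Literature.AlgebraicGeometry.HodgeTheory.GysinCleanBaseChange
import HarnessLib

/-!
# Ring 2 · sub-cell AbelianAll (ALL ABELIAN VARIETIES), André axis, part XXXVII-g₁ — CORRESPONDENCES ON ONE FIBRE OF THE SQUARE:
# `(φ × 1)^*` COMMUTES WITH THE ACTION EXACTLY (`[(φ × 1)^* γ]_* = φ^* ∘ [γ]_*`), a class of `(ν_t × 1)^*`-weight `N¹` acts only on `H¹`,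
# the diagonal acts as the identity, and the relative diagonal of `𝒳 ×_S 𝒳` restricts to a multiple of the diagonal of `X_t × X_t`

Gen-29 file of the `ab-andre-2` seat (cell `pub-hodge-ring2`, sub-cell AbelianAll = ALL abelian varieties, not Weil-type-only), continuing
parts XXXVII-a–f. Honest framing (LEAD bus, REFEREE report-03 §5): research route, not a corollary; conditional on HC_CM plus one named
minimal statement.

## What this file proves (sorry-free, standard axioms only)

Part XXXVII-g (the middle block `(ρ) = R₁` of ring2-b05's `B(X)`-assembly in degree `2`) compares two algebraic classes of top `θ_N`-weight
on the fibre square `𝒴 = 𝒳 ×_S 𝒳` through their restrictions to ONE fibre `Y_t ≅ X_t × X_t` (part XXXVII-c's vanishing principle), read as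
correspondences of `X_t`. This file supplies the fibre-side identities, all EXACT (no undetermined scalars), for a smooth projective `X`
of dimension `n` and `φ : X ⟶ X`:

* §1 **`φ^* ∘ pr_{1*} = pr_{1*} ∘ (φ × 1)^*` on `H^•(X × X)`** (`map_gysin_fst_eq_gysin_fst_map_whiskerRight`): both sides are linear and
  agree on the Künneth generators `pr₁^* x ∪ pr₂^* y` — for `deg y < 2n` both vanish (`complexGysin_cup_map_eq_zero_of_lt`), for
  `deg y > 2n` `y = 0`, for `deg y = 2n` the projection formula leaves `φ^* x ∪ φ^*(c · 1) = φ^* x ∪ c · 1` on both sides (the SAME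
  fibre integral `pr_{1*} pr₂^* y = c · 1 ∈ H⁰(X)`, `φ^* 1 = 1`). Hence **`[(φ × 1)^* γ]_* c = φ^*([γ]_* c)`** (`corrAction_map_whiskerRight`)
  and the same for polynomials `P((φ × 1)^*)` (`corrAction_aeval_map_whiskerRight`).
* §1 **SELECTION RULE ON THE FIBRE** (`corrAction_eq_zero_of_whiskerRight_weight`): if `φ^* = Nᵘ` on every `Hᵘ(X)` (`N ≥ 2`) and
  `(φ × 1)^* γ = Nʷ · γ` for `γ ∈ H^{2n}(X × X)`, then `[γ]_*` vanishes on `Hᵃ(X)` for every `a ≠ w`: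
  `Nʷ · [γ]_* c = [(φ × 1)^* γ]_* c = φ^*([γ]_* c) = Nᵃ · [γ]_* c`.
* §1 **THE DIAGONAL ACTS AS THE IDENTITY** (`corrAction_diagonal_one`): `pr_{1*}(pr₂^* c ∪ Δ_* 1) = pr_{1*} Δ_*(Δ^* pr₂^* c) = c`.
* §2 **THE RELATIVE DIAGONAL RESTRICTS TO A MULTIPLE OF THE DIAGONAL** (`exists_map_relDiagonal_eq_smul`): for the relative diagonal
  `Δ : 𝒳 ⟶ 𝒳 ×_S 𝒳` of a compact pencil of abelian `d`-folds and the identification `E : X_t × X_t ≅ Y_t` of part XXXVI,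
  `(E ≫ J_t)^*(Δ_* 1) = K · Δ_{X_t *} 1` for some `K ∈ ℂ` (clean base change, the tree's `complexGysin_cleanBaseChange`, for the cartesian
  square `X_t → 𝒳`, `X_t → X_t × X_t → 𝒳 ×_S 𝒳`: a point `(P, Q)` with `Δ P = (E ≫ J_t) Q` has `Q = (R, R)`, `P = j_t R`).

## Documentary interface — PRINT / LEAN / GAP

PRINT: Fulton, *Intersection theory*, Prop. 1.7, Thm. 6.2 (a), §16.1 (correspondences, base change); Fulton, *Young tableaux*, App. B
§B.1 (5)–(7); Voisin, *Hodge theory II*, (10.7)–(10.8); Hatcher Thm. 3.15 (Künneth); Mumford, *Abelian varieties*, §19 (`[N]^* = Nᵘ`).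
LEAN: the displayed theorems, fact-free.
GAP: none for the displayed statements; they serve part XXXVII-g₂ (`(ρ) = R₁` of ring2-b05 from one algebraic divisor class on the square).
-/

noncomputable section

set_option linter.dupNamespace false

namespace Summit.HodgeConjecture.HodgeConjecture.Ring2.AbelianAll

open CategoryTheory CategoryTheory.Limits AlgebraicGeometry MonoidalCategory CartesianMonoidalCategory
open Literature.AlgebraicGeometry Literature.AlgebraicGeometry.Motives
open Literature.AlgebraicGeometry.HodgeTheory
open Literature.AlgebraicTopology.SingularHomology (singularCohomology cupProduct cupProduct_map cupProduct_one one_cupProduct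
  cupProduct_assoc cupProduct_gradedComm_holds)

/-! ## §1 Correspondences of `X × X` and the partial endomorphism `φ × 1` -/

section Fibre

variable {X : SchemeOver ℂ} {n : ℕ}

/-- **`φ^* ∘ pr_{1*} = pr_{1*} ∘ (φ × 1)^*` EXACTLY on `H^•((X × X)(ℂ); ℂ)`** for an endomorphism `φ` of a smooth projective `X`: checked on
the Künneth generators `pr₁^* x ∪ pr₂^* y` — `deg y < 2 dim X`: both sides vanish; `deg y > 2 dim X`: `y = 0`; `deg y = 2 dim X`: the
projection formula and `pr_{1*} pr₂^* y ∈ H⁰(X) = ℂ · 1`, `φ^* 1 = 1`. [cite: Fulton1998, Prop. 1.7]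
[cite: FultonYoungTableaux1997, Appendix B §B.1 (5)–(6)] [cite: HatcherAT2002, §3.2 Thm. 3.15] -/
theorem map_gysin_fst_eq_gysin_fst_map_whiskerRight (μ : OrientationFamily) (hX : IsSmoothProjective n X) (φ : X ⟶ X) {k k₁ : ℕ}
    (hk : k + 2 * n = k₁ + 2 * (n + n)) (u : complexBetti (X ⊗ X) k) :
    complexBetti.map φ k₁ (complexGysin μ (IsSmoothProjective.tensor_holds hX hX) hX (fst X X) hk u) =
      complexGysin μ (IsSmoothProjective.tensor_holds hX hX) hX (fst X X) hk (complexBetti.map (φ ▷ X) k u) := by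
  have hμ : μ.HasPoincareDuality := OrientationFamily.hasPoincareDuality μ
  have hXX := IsSmoothProjective.tensor_holds hX hX
  refine Submodule.span_induction (p := fun u _ ↦ complexBetti.map φ k₁ (complexGysin μ hXX hX (fst X X) hk u) =
      complexGysin μ hXX hX (fst X X) hk (complexBetti.map (φ ▷ X) k u)) ?_ ?_ ?_ ?_ (kunnethSpan_complexBetti hX hX k u)
  · rintro _ ⟨i, j, h, x, y, rfl⟩
    rw [map_whiskerRight_cross φ h x y]
    rcases Nat.lt_trichotomy j (2 * n) with hlt | heq | hgt
    · rw [complexGysin_cup_map_eq_zero_of_lt hXX hX (fst X X) h hk (by omega) x _,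
        complexGysin_cup_map_eq_zero_of_lt hXX hX (fst X X) h hk (by omega) (complexBetti.map φ i x) _, map_zero]
    · subst heq
      obtain rfl : k₁ = i := by omega
      have hq : 2 * n + 2 * n = 0 + 2 * (n + n) := by ring
      rw [complexGysin_cup hμ hXX hX (fst X X) h hk hq (Nat.add_zero k₁) x _,
        complexGysin_cup hμ hXX hX (fst X X) h hk hq (Nat.add_zero k₁) (complexBetti.map φ k₁ x) _]
      obtain ⟨c, hc⟩ := eq_smul_one_of_degree_zero hX
        (complexGysin μ hXX hX (fst X X) hq (complexBetti.map (snd X X) (2 * n) y))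
      rw [hc]
      simp only [map_smul, cupProduct_one]
    · haveI := subsingleton_complexBetti hX hgt
      rw [Subsingleton.elim y 0]
      simp only [map_zero]
  · simp only [map_zero]
  · intro u v _ _ hu hv
    simp only [map_add, hu, hv]
  · intro c u _ hu
    simp only [map_smul, hu]

/-- **`[(φ × 1)^* γ]_* c = φ^*([γ]_* c)`** (`pr₂ ∘ (φ × 1) = pr₂` and `φ^* pr_{1*} = pr_{1*} (φ × 1)^*`). [cite: VoisinHodgeII2003, proof of Thm. 10.17 (10.7)–(10.8)]
[cite: Fulton1998, Prop. 1.7 and §16.1] -/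
theorem corrAction_map_whiskerRight (μ : OrientationFamily) (hX : IsSmoothProjective n X) (φ : X ⟶ X) {e a b : ℕ} (hab : a + 2 * e = b + 2 * n)
    (γ : complexBetti (X ⊗ X) (2 * e)) (c : complexBetti X a) :
    corrAction μ hX hX hab (complexBetti.map (φ ▷ X) (2 * e) γ) c = complexBetti.map φ b (corrAction μ hX hX hab γ c) := by
  rw [corrAction_apply, corrAction_apply, map_gysin_fst_eq_gysin_fst_map_whiskerRight μ hX φ, complexBetti.map_cupProduct,
    ← complexBetti.map_comp_apply' (φ ▷ X) (snd X X), whiskerRight_snd]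

/-- **`[P((φ × 1)^*) γ]_* c = P(φ^*)([γ]_* c)`** for every polynomial `P` (part XXXVII-c's transport of polynomials along an intertwiner).
[cite: VoisinHodgeII2003, proof of Thm. 10.17 (10.7)–(10.8)] [cite: Kleiman1968AlgebraicCycles, §1.4] -/
theorem corrAction_aeval_map_whiskerRight (μ : OrientationFamily) (hX : IsSmoothProjective n X) (φ : X ⟶ X) {e a b : ℕ}
    (hab : a + 2 * e = b + 2 * n) (P : Polynomial ℂ) (γ : complexBetti (X ⊗ X) (2 * e)) (c : complexBetti X a) :
    corrAction μ hX hX hab (Polynomial.aeval (complexBetti.map (φ ▷ X) (2 * e)).hom P γ) c =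
      Polynomial.aeval (complexBetti.map φ b).hom P (corrAction μ hX hX hab γ c) := by
  have h := aeval_apply_of_comm ((corrAction μ hX hX hab).flip c) (complexBetti.map (φ ▷ X) (2 * e)).hom (complexBetti.map φ b).hom
    (LinearMap.ext fun γ ↦ corrAction_map_whiskerRight μ hX φ hab γ c) P γ
  simpa only [LinearMap.flip_apply] using h

/-- **SELECTION RULE ON THE FIBRE.** If `φ^*` is `Nᵘ` on every `Hᵘ(X)` (`N ≥ 2`; e.g. `φ = [N]` on an abelian variety) and
`(φ × 1)^* γ = Nʷ · γ` for `γ ∈ H^{2 dim X}(X × X)`, then the degree-`0` correspondence `[γ]_*` VANISHES on `Hᵃ(X)` for every `a ≠ w`: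
`Nʷ · [γ]_* c = φ^*([γ]_* c) = Nᵃ · [γ]_* c`. [cite: Kleiman1968AlgebraicCycles, §1.4 and Thm. 2A9] [cite: MumfordAV1970, §19]
[cite: VoisinHodgeII2003, (10.8)] -/
theorem corrAction_eq_zero_of_whiskerRight_weight (hX : IsSmoothProjective n X) (φ : X ⟶ X) {N : ℕ} (hN : 2 ≤ N)
    (hφ : ∀ (u : ℕ) (x : complexBetti X u), complexBetti.map φ u x = ((N : ℂ) ^ u) • x)
    {γ : complexBetti (X ⊗ X) (2 * n)} {w : ℕ} (hγ : complexBetti.map (φ ▷ X) (2 * n) γ = ((N : ℂ) ^ w) • γ) {a : ℕ} (ha : a ≠ w)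
    (c : complexBetti X a) :
    corrAction complexOrientationFamily hX hX (rfl : a + 2 * n = a + 2 * n) γ c = 0 := by
  have h := corrAction_map_whiskerRight complexOrientationFamily hX φ (rfl : a + 2 * n = a + 2 * n) γ c
  rw [hγ, map_smul, LinearMap.smul_apply, hφ] at h
  have hne : (N : ℂ) ^ w ≠ (N : ℂ) ^ a := by
    intro h1
    have h2 : N ^ w = N ^ a := by exact_mod_cast h1
    exact ha (Nat.pow_right_injective hN h2).symm
  have h0 : ((N : ℂ) ^ w - (N : ℂ) ^ a) • corrAction complexOrientationFamily hX hX (rfl : a + 2 * n = a + 2 * n) γ c = 0 := by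
    rw [sub_smul, h, sub_self]
  exact (smul_eq_zero.1 h0).resolve_left (sub_ne_zero.2 hne)

/-- **THE DIAGONAL ACTS AS THE IDENTITY**: `pr_{1*}(pr₂^* c ∪ Δ_* 1) = pr_{1*} Δ_*(Δ^* pr₂^* c ∪ 1) = (Δ ≫ pr₁)_*((Δ ≫ pr₂)^* c) = c`.
[cite: Fulton1998, §16.1 (the diagonal is the identity correspondence)] [cite: FultonYoungTableaux1997, Appendix B §B.1 (5)–(6)] -/
theorem corrAction_diagonal_one (μ : OrientationFamily) (hX : IsSmoothProjective n X) (hΔ : 0 + 2 * (n + n) = 2 * n + 2 * n) {a : ℕ}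
    (c : complexBetti X a) :
    corrAction μ hX hX (rfl : a + 2 * n = a + 2 * n)
      (complexGysin μ hX (IsSmoothProjective.tensor_holds hX hX) (lift (𝟙 X) (𝟙 X)) hΔ (singularCohomology.one ℂ (ComplexPoints X))) c = c := by
  have hμ : μ.HasPoincareDuality := OrientationFamily.hasPoincareDuality μ
  have hXX := IsSmoothProjective.tensor_holds hX hX
  rw [corrAction_apply]
  have hproj := complexGysin_cup hμ hX hXX (lift (𝟙 X) (𝟙 X)) (Nat.add_zero a) (show a + 2 * (n + n) = (a + 2 * n) + 2 * n by ring) hΔ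
    (rfl : a + 2 * n = a + 2 * n) (complexBetti.map (snd X X) a c) (singularCohomology.one ℂ (ComplexPoints X))
  rw [← hproj, cupProduct_one, ← complexBetti.map_comp_apply', lift_snd, complexBetti.map_id, ModuleCat.id_apply, ← LinearMap.comp_apply,
    ← complexGysin_comp hμ hX hXX hX (lift (𝟙 X) (𝟙 X)) (fst X X), lift_fst, complexGysin_id hμ hX a, LinearMap.id_apply]

end Fibre

/-! ## §2 The relative diagonal of the fibre square restricted to one fibre -/

section Square

variable {𝒳 S : SchemeOver ℂ} {d : ℕ} {f : 𝒳 ⟶ S}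

/-- `𝒴` — the fibre square `𝒳 ×_S 𝒳` (display notation for the tree's `familyPullback f f`). -/
local notation3 (prettyPrint := false) "𝒴[" f "]" => familyPullback f f
/-- `𝐚` — the first projection `𝒳 ×_S 𝒳 ⟶ 𝒳`. -/
local notation3 (prettyPrint := false) "𝐚[" f "]" => familyPullback.fst f f
/-- `𝐛` — the second projection `𝒳 ×_S 𝒳 ⟶ 𝒳` (the pencil structure of the square is `𝐛 ≫ f`). -/
local notation3 (prettyPrint := false) "𝐛[" f "]" => familyPullback.snd f f
/-- `hY⟦hf⟧` — smoothness-projectivity of the total space of the square pencil (part XXXVI-c). -/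
local notation3 (prettyPrint := false) "hY⟦" hf "⟧" =>
  IsCompactAbelianPencil.isSmoothProjective_total (isCompactAbelianPencil_square hf rfl)

/-- **THE RELATIVE DIAGONAL RESTRICTS TO A MULTIPLE OF THE DIAGONAL OF THE FIBRE**: for a section-pair `Δ : 𝒳 ⟶ 𝒳 ×_S 𝒳` of the two
projections (the relative diagonal) and the identification `E : X_t × X_t ≅ Y_t`, `(E ≫ J_t)^*(Δ_* 1) = K · (Δ_{X_t})_* 1` in
`H^{2d}(X_t × X_t)` (any spelling `kk` of the degree `2d`) — clean base change for the cartesian square with corners `X_t` (maps `j_t` and `Δ_{X_t}`), `𝒳`, `X_t × X_t`,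
`𝒳 ×_S 𝒳`: a pair of points `P ∈ 𝒳(ℂ)`, `Q ∈ (X_t × X_t)(ℂ)` with `Δ P = (E ≫ J_t) Q` is `P = j_t R`, `Q = (R, R)`.
[cite: Fulton1998, Thm. 6.2 (a) and Prop. 1.7] [cite: VoisinHodgeII2003, §4.3.3 Thm. 4.24] -/
theorem exists_map_relDiagonal_eq_smul (hf : IsCompactAbelianPencil f d) (t : ComplexPoints S) (Δ : 𝒳 ⟶ 𝒴[f]) (hΔa : Δ ≫ 𝐚[f] = 𝟙 𝒳)
    (hΔb : Δ ≫ 𝐛[f] = 𝟙 𝒳) (E : fiberOver f t ⊗ fiberOver f t ≅ fiberOver (𝐛[f] ≫ f) t)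
    (hEa : E.hom ≫ fiberι (𝐛[f] ≫ f) t ≫ 𝐚[f] = fst _ _ ≫ fiberι f t) (hEb : E.hom ≫ fiberι (𝐛[f] ≫ f) t ≫ 𝐛[f] = snd _ _ ≫ fiberι f t)
    {kk : ℕ} (hdeg : 0 + 2 * (d + d + 1) = kk + 2 * (d + 1)) (hdeg' : 0 + 2 * (d + d) = kk + 2 * d) :
    ∃ K : ℂ, complexBetti.map (E.hom ≫ fiberι (𝐛[f] ≫ f) t) kk
        (complexGysin complexOrientationFamily hf.isSmoothProjective_total hY⟦hf⟧ Δ hdeg (singularCohomology.one ℂ (ComplexPoints 𝒳))) =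
      K • complexGysin complexOrientationFamily (hf.isSmoothProjective_fiberOver t)
        (IsSmoothProjective.tensor_holds (hf.isSmoothProjective_fiberOver t) (hf.isSmoothProjective_fiberOver t))
        (lift (𝟙 (fiberOver f t)) (𝟙 (fiberOver f t))) hdeg' (singularCohomology.one ℂ (ComplexPoints (fiberOver f t))) := by
  haveI : IsSeparated S.hom := hf.isSmoothProjective_base.isProjectiveOver.isProper.toIsSeparated
  have hXt := hf.isSmoothProjective_fiberOver t
  have hXX := IsSmoothProjective.tensor_holds hXt hXt
  haveI : IsClosedImmersion (fiberι f t).left := Motives.isClosedImmersion_fiberι_left f t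
  haveI : IsClosedImmersion (lift (fiberι f t) (lift (𝟙 (fiberOver f t)) (𝟙 (fiberOver f t)))).left :=
    isClosedImmersion_lift_left_of_isSmoothProjective hXX (fiberι f t) _
  -- incidence
  have hinc : ∀ (P : ComplexPoints 𝒳) (Q : ComplexPoints (fiberOver f t ⊗ fiberOver f t)),
      AlgPoints.map Δ P = AlgPoints.map (E.hom ≫ fiberι (𝐛[f] ≫ f) t) Q →
      ∃ R : ComplexPoints (fiberOver f t), AlgPoints.map (fiberι f t) R = P ∧
        AlgPoints.map (lift (𝟙 (fiberOver f t)) (𝟙 (fiberOver f t))) R = Q := by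
    intro P Q h
    have h1 : AlgPoints.map (fiberι f t) (AlgPoints.map (fst _ _) Q) = P := by
      rw [← AlgPoints.map_comp_apply, ← hEa, ← Category.assoc, AlgPoints.map_comp_apply, ← h, ← AlgPoints.map_comp_apply, hΔa,
        AlgPoints.map_id_apply]
    have h2 : AlgPoints.map (fiberι f t) (AlgPoints.map (snd _ _) Q) = P := by
      rw [← AlgPoints.map_comp_apply, ← hEb, ← Category.assoc, AlgPoints.map_comp_apply, ← h, ← AlgPoints.map_comp_apply, hΔb,
        AlgPoints.map_id_apply]
    have h12 : AlgPoints.map (fst _ _) Q = AlgPoints.map (snd _ _) Q := AlgPoints.map_injective (fiberι f t) (h1.trans h2.symm)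
    refine ⟨AlgPoints.map (fst _ _) Q, h1, AlgPoints.prodEquiv.injective (Prod.ext ?_ ?_)⟩
    · rw [AlgPoints.prodEquiv_apply_fst, AlgPoints.prodEquiv_apply_fst, ← AlgPoints.map_comp_apply, lift_fst, AlgPoints.map_id_apply]
    · rw [AlgPoints.prodEquiv_apply_snd, AlgPoints.prodEquiv_apply_snd, ← AlgPoints.map_comp_apply, lift_snd, AlgPoints.map_id_apply, h12]
  obtain ⟨K, hK⟩ := complexGysin_cleanBaseChange complexOrientationFamily hf.isSmoothProjective_total hY⟦hf⟧ hXX hXt Δ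
    (E.hom ≫ fiberι (𝐛[f] ≫ f) t) (fiberι f t) (lift (𝟙 (fiberOver f t)) (𝟙 (fiberOver f t))) (by omega) hinc
  refine ⟨K, ?_⟩
  have hone : complexBetti.map (fiberι f t) 0 (singularCohomology.one ℂ (ComplexPoints 𝒳)) =
      singularCohomology.one ℂ (ComplexPoints (fiberOver f t)) := singularCohomology.map_one _
  rw [hK hdeg, hone]

end Square

end Summit.HodgeConjecture.HodgeConjecture.Ring2.AbelianAll

end
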